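import Summits.QuantumFields.BalabanUV.Beta.WardLocusResidualClass
import Summits.QuantumFields.BalabanUV.Beta.SpineRecursivePureParity
import Summits.QuantumFields.BalabanUV.Beta.SpineRootedW2

/-!
# `BalabanUV.Beta.WardLocusResidualWall` — binder row D1, (L4) W-side of hW, «HW-CLASS-Q» part 2: THE CLASS AND THE ROW PARITY OF THE WARD RESIDUAL OF THE
# W-LITERAL AT THE WALL OBJECTS, and of the TRANSPORTED remainder of the next level — the two invariants the all-levels hW induction carries
# (β sub-cell, D1 formalisation swarm, unit `b2b-balaban-beta-d1-formalise-leaf-06`, gen 3; CLAIM «D1-hW-L4-WARD-ALL» journal 2026-08-20)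

NOT IN PRINT; OUR BOOKKEEPING.  HONEST FRAMING (cell charter, verbatim): «discharging `BetaPertH` makes Bałaban's UV stability UNCONDITIONAL — a real
constructive-QFT result; it is NOT the continuum limit and NOT the Clay problem.»  HONEST DEPENDENCY (verbatim): «continuum YM on T⁴ ⇐ BetaPertH ∧ nine spine
estimates (0/9 proved); BetaPertH ⇐ (D1) ∧ (D4) ∧ CAP+tail; G-an2-4 gates asym, D1 and NE2/3/4.»  [folklore] bookkeeping over part 1 (`WardLocusResidualClass`),
an1-g27's parity engine (`KernelWardResidual.parityOdd_residual`, `parityOdd_dM`) and leaf-05's toolkit (`SpineRecursiveParity`, `SpineRecursivePureParity`) BY NAME;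
the remainder tables `R`, `R″`, `RM`, `RB` and their classes / parities are DISPLAYED HYPOTHESES; nothing of Bałaban's papers, no `[cite:]`, no `def`, no
`def … : Prop`; instantiates NO binder of the β-function wall.  NOT hW, NOT D1, NOT `BetaPertH`, NOT continuum, NOT Clay.

The RESIDUAL SHAPE at level `j` (the `½ • (𝒩 + 𝒩″)` of `WardLocusRecursiveStep.divW_WrecAt_of_tableLaws`, kernel `G_j = coDressKBmAt ρ Lc (KInvStep Lc j)`, tables
`SpureRecAt j` / `M1At j`, generator `diagK (½ • Σ_v legInd ρ (Lc•y+v))`, constant `(stepScale j·Lc^{d+1})⁻¹`, remainders `R y`, `R″ y`, `RM y`):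
* §1 `exists_vertexFamily_residual_wall` — it is a VERTEX FAMILY in `(ν, y′)` with constants UNIFORM in `y` as soon as `R y`, `R″ y` are local-stencil and `RM y`
  vertex families at one rate; `parityOdd_residual_wall` — it is ROW-PARITY-ODD as soon as the rows of `R y`, `R″ y`, `RM y` are (those of `SpureRecAt j`, `M1At j`
  are: leaf-05's `trK_SpureRecAt`, `trK_M1At`).
* §2 `exists_locStencil_transport_wall` / `exists_bound_transport_wall` / `parityOdd_transport_wall` — the next level's first-slot remainder
  `Y κ′ u′ ↦ −c • Σ_{v ∈ box} mmRead Lc (G_j ∘ 𝒩 (Lc•Y+v) κ′ u′ ∘ G_j) + RB Y κ′ u′` is a local-stencil family (uniformly in `Y`), uniformly bounded, and row-parity-odd,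
  from the same data of `𝒩` (vertex-family class ∀ coarse sites, row parity) and of the border remainder `RB`.
Provenance: D1 formalisation swarm, leaf prover 06 (gen 3), 2026-08-20; no existing file touched.
-/

noncomputable section

open Finset
open scoped BigOperators
open Literature.MathematicalPhysics.QuantumFieldTheory
open Literature.MathematicalPhysics.QuantumFieldTheory.Balaban1983to89
open Literature.MathematicalPhysics.QuantumFieldTheory.Balaban1983to89.Beta
open B12Sec2to5 (l1 l1_nonneg)
open ExpKernelCalculus (MKer Decays BiLoc VertexFamily comp)
open KernelWard (divV divW bdd_of_biLoc)
open AffineAveraging (Site box toSite)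
open OneStepResolventKernel (Fib wsum LocStencil biLoc_mono decays_mono)
open OneStepKernelFamily (KInvStep colH vertexOfK)
open InterLevelTransport (cwsum)
open BalabanStepJetsSucc (mmRead)
open SecondOrderResponse (colM vertexOfM dM)
open StepJetData (locStencil_add locStencil_smul)
open Summit.QuantumFields.BalabanUV.Beta.TameKernelCalculus
open Summit.QuantumFields.BalabanUV.Beta.BorderedHessian (diagK stepScale sgnK)
open Summit.QuantumFields.BalabanUV.Beta.ChartConjugation (conjV)
open Summit.QuantumFields.BalabanUV.Beta.AveragingWardRootedStencils (legInd)
open Summit.QuantumFields.BalabanUV.Beta.AxialDressingRooted (coDressKBmAt decays_coDressKBmAt_KInvStep)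
open Summit.QuantumFields.BalabanUV.Beta.SpineRooted (SpureRecAt M1At locStencil_SpureRecAt vertexFamily_M1At)
open Summit.QuantumFields.BalabanUV.Beta.KernelWardRelative (gaugeWt)
open Summit.QuantumFields.BalabanUV.Beta.KernelWardResidual (parityOdd_residual parityOdd_dM parityOdd_sub)
open Summit.QuantumFields.BalabanUV.Beta.KernelWardRemainderParity (parityOdd_add)
open Summit.QuantumFields.BalabanUV.Beta.SpineRecursiveParity (parityOdd_smul parityOdd_sum parityOdd_sandwich parityOdd_mmRead trK_M1At)
open Summit.QuantumFields.BalabanUV.Beta.SpineRecursivePureParity (trK_SpureRecAt)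
open Summit.QuantumFields.BalabanUV.Beta.BubbleParity (spr_of_decays trK_coDressKBmAt_KInvStep)
open Summit.QuantumFields.BalabanUV.Beta.WardLocusResidualClass (exists_vertexFamily_residual exists_vertexFamily_residual'' exists_vertexFamily_halfSum
  exists_locStencil_transport abs_blockGen_le)

namespace Summit.QuantumFields.BalabanUV.Beta.WardLocusResidualWall

section Wall

variable {d Lc : ℕ} [NeZero Lc]

/-! ## §1 The residual of `hWd j` at the wall objects: vertex-family class and row parity -/

/-- [folklore] **THE WARD RESIDUAL OF THE W-LITERAL IS A VERTEX FAMILY IN ITS BOND VARIABLE, UNIFORMLY IN THE COARSE SITE** (in-block root, any level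
`j`, any `cΛ`, the hW Ward pin): for remainders `R y`, `R″ y` local-stencil families and `RM y` vertex families at one rate `mR > 0`, the residual
`½ • (𝒩 + 𝒩″)` of `WardLocusRecursiveStep.divW_WrecAt_of_tableLaws` satisfies `∀ y, VertexFamily (fun ν y′ ↦ …) Lc C δ` for some `C`, `δ > 0` (part 1 at the wall:
`decays_coDressKBmAt_KInvStep`, `locStencil_SpureRecAt`, `vertexFamily_M1At`, `abs_blockGen_le`). -/
theorem exists_vertexFamily_residual_wall (hLc : 1 ≤ Lc) {r : Fin (d + 1) → ℕ} (hr : r ∈ box (d + 1) Lc) (cΛ : ℝ) (j : ℕ)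
    {R R'' : (Fin (d + 1) → ℤ) → Fin (d + 1) → (Fin (d + 1) → ℤ) → MKer (d + 1) (Fib d)}
    {RM : (Fin (d + 1) → ℤ) → Fin (d + 1) → (Fin (d + 1) → ℤ) → MKer (d + 1) (Fib d)} {CR CR'' CRM mR mR'' mRM : ℝ}
    (hmR : 0 < mR) (hRl : ∀ y, LocStencil (R y) CR mR) (hmR'' : 0 < mR'') (hR''l : ∀ y, LocStencil (R'' y) CR'' mR'')
    (hmRM : 0 < mRM) (hRMl : ∀ y, VertexFamily (RM y) Lc CRM mRM) :
    ∃ C δ : ℝ, 0 < δ ∧ ∀ y : Fin (d + 1) → ℤ, VertexFamily (fun ν y' => (1 / 2 : ℝ) • (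
          (dM (coDressKBmAt (toSite r) Lc (KInvStep (d := d) Lc j)) Lc (R y) (RM y) ν y'
            - (stepScale d Lc j * (Lc : ℝ) ^ (d + 1))⁻¹ • (∑ κ, wsum (fun u => ∑' x₂, ∑ κ₂,
                comp (coDressKBmAt (toSite r) Lc (KInvStep (d := d) Lc j))
                  (dM (coDressKBmAt (toSite r) Lc (KInvStep (d := d) Lc j)) Lc
                    (SpureRecAt d Lc (toSite r) ((Lc : ℝ) ^ (d + 1)) (-((Lc : ℝ) ^ (d + 1) * (1 / 2) * (Lc : ℝ) ^ (d + 1))) cΛ j)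
                    (M1At d Lc (toSite r) cΛ j) ν y') u x₂ (Sum.inl κ) (Sum.inl κ₂) * gaugeWt Lc y κ₂ x₂)
                (SpureRecAt d Lc (toSite r) ((Lc : ℝ) ^ (d + 1)) (-((Lc : ℝ) ^ (d + 1) * (1 / 2) * (Lc : ℝ) ^ (d + 1))) cΛ j κ)
              + ∑ ρ', cwsum Lc (fun w => ∑' x₂, ∑ κ₂,
                comp (coDressKBmAt (toSite r) Lc (KInvStep (d := d) Lc j))
                  (dM (coDressKBmAt (toSite r) Lc (KInvStep (d := d) Lc j)) Lc
                    (SpureRecAt d Lc (toSite r) ((Lc : ℝ) ^ (d + 1)) (-((Lc : ℝ) ^ (d + 1) * (1 / 2) * (Lc : ℝ) ^ (d + 1))) cΛ j)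
                    (M1At d Lc (toSite r) cΛ j) ν y') ((Lc : ℤ) • w) x₂ (Sum.inr ρ') (Sum.inl κ₂) * gaugeWt Lc y κ₂ x₂)
                (M1At d Lc (toSite r) cΛ j ρ')))
          + (dM (coDressKBmAt (toSite r) Lc (KInvStep (d := d) Lc j)) Lc (R'' y) (RM y) ν y'
            + dM (conjV (coDressKBmAt (toSite r) Lc (KInvStep (d := d) Lc j))
                (diagK (((1 : ℝ) / 2) • ∑ v ∈ box (d + 1) Lc, legInd (toSite r) ((Lc : ℤ) • y + toSite v)))) Lc
              (SpureRecAt d Lc (toSite r) ((Lc : ℝ) ^ (d + 1)) (-((Lc : ℝ) ^ (d + 1) * (1 / 2) * (Lc : ℝ) ^ (d + 1))) cΛ j)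
              (M1At d Lc (toSite r) cΛ j) ν y'))) Lc C δ := by
  set cE : ℝ := (Lc : ℝ) ^ (d + 1) with hcE
  set cVH : ℝ := -((Lc : ℝ) ^ (d + 1) * (1 / 2) * (Lc : ℝ) ^ (d + 1)) with hcVH
  obtain ⟨δK, CK, hδK, hCK, hKd⟩ := decays_coDressKBmAt_KInvStep (d := d) hr j
  obtain ⟨Cs, δs, hδs, hS⟩ := locStencil_SpureRecAt (d := d) hLc hr cE cVH cΛ j
  -- one common rate
  set m : ℝ := min (min mR (min mR'' mRM)) (min δs δK) with hmdef
  have hm : 0 < m := lt_min (lt_min hmR (lt_min hmR'' hmRM)) (lt_min hδs hδK)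
  have hmR' : m ≤ mR := (min_le_left _ _).trans (min_le_left _ _)
  have hmR''' : m ≤ mR'' := (min_le_left _ _).trans ((min_le_right _ _).trans (min_le_left _ _))
  have hmRM' : m ≤ mRM := (min_le_left _ _).trans ((min_le_right _ _).trans (min_le_right _ _))
  have hmS : m ≤ δs := (min_le_right _ _).trans (min_le_left _ _)
  have hmK : m ≤ δK := (min_le_right _ _).trans (min_le_right _ _)
  have hKd' : Decays (coDressKBmAt (toSite r) Lc (KInvStep (d := d) Lc j)) CK m := decays_mono hKd hCK le_rfl hmK
  have hS' : LocStencil (SpureRecAt d Lc (toSite r) cE cVH cΛ j) (|Cs|) m := fun κ u => biLoc_of_le (hS κ u) hmS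
  have hM' := vertexFamily_M1At hLc hr cΛ j hm.le
  have hRl' : ∀ y, LocStencil (R y) (|CR|) m := fun y κ u => biLoc_of_le (hRl y κ u) hmR'
  have hR''l' : ∀ y, LocStencil (R'' y) (|CR''|) m := fun y κ u => biLoc_of_le (hR''l y κ u) hmR'''
  have hRMl' : ∀ y, VertexFamily (RM y) Lc (|CRM|) m := fun y ρ' w => biLoc_of_le (hRMl y ρ' w) hmRM'
  obtain ⟨C₁, h₁⟩ := exists_vertexFamily_residual hKd' hCK hm hS' hM' hRl' hRMl' ((stepScale d Lc j * (Lc : ℝ) ^ (d + 1))⁻¹)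
  obtain ⟨C₂, h₂⟩ := exists_vertexFamily_residual'' hKd' hCK hm hS' hM' hR''l' hRMl'
    (g := fun y => ((1 : ℝ) / 2) • ∑ v ∈ box (d + 1) Lc, legInd (toSite r) ((Lc : ℤ) • y + toSite v))
    (fun y z b => abs_blockGen_le Lc (toSite r) ((1 : ℝ) / 2) y z b)
  obtain ⟨C', h'⟩ := exists_vertexFamily_halfSum (show m / 8 ≤ m / 2 by linarith [hm.le]) h₁ h₂
  exact ⟨C', m / 8, by positivity, h'⟩

/-- [folklore] **THE WARD RESIDUAL OF THE W-LITERAL IS ROW-PARITY-ODD** (any root, any level, any `cΛ`, at the pin; no class needed): if the rows of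
`R y`, `R″ y`, `RM y` are parity-odd, so is `½ • (𝒩 + 𝒩″)` — an1's `parityOdd_residual` + `parityOdd_dM` ×2 with leaf-05's `trK_SpureRecAt` / `trK_M1At`
(in-block root for `trK_SpureRecAt`). -/
theorem parityOdd_residual_wall (hLc : 1 ≤ Lc) {r : Fin (d + 1) → ℕ} (hr : r ∈ box (d + 1) Lc) (cΛ : ℝ) (j : ℕ)
    {R R'' : (Fin (d + 1) → ℤ) → Fin (d + 1) → (Fin (d + 1) → ℤ) → MKer (d + 1) (Fib d)}
    {RM : (Fin (d + 1) → ℤ) → Fin (d + 1) → (Fin (d + 1) → ℤ) → MKer (d + 1) (Fib d)}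
    (hRp : ∀ y κ u, trK (R y κ u) = -sgnK (R y κ u)) (hR''p : ∀ y κ u, trK (R'' y κ u) = -sgnK (R'' y κ u))
    (hRMp : ∀ y ρ' w, trK (RM y ρ' w) = -sgnK (RM y ρ' w)) (y : Fin (d + 1) → ℤ) (ν : Fin (d + 1)) (y' : Fin (d + 1) → ℤ) :
    trK ((1 / 2 : ℝ) • (
          (dM (coDressKBmAt (toSite r) Lc (KInvStep (d := d) Lc j)) Lc (R y) (RM y) ν y'
            - (stepScale d Lc j * (Lc : ℝ) ^ (d + 1))⁻¹ • (∑ κ, wsum (fun u => ∑' x₂, ∑ κ₂,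
                comp (coDressKBmAt (toSite r) Lc (KInvStep (d := d) Lc j))
                  (dM (coDressKBmAt (toSite r) Lc (KInvStep (d := d) Lc j)) Lc
                    (SpureRecAt d Lc (toSite r) ((Lc : ℝ) ^ (d + 1)) (-((Lc : ℝ) ^ (d + 1) * (1 / 2) * (Lc : ℝ) ^ (d + 1))) cΛ j)
                    (M1At d Lc (toSite r) cΛ j) ν y') u x₂ (Sum.inl κ) (Sum.inl κ₂) * gaugeWt Lc y κ₂ x₂)
                (SpureRecAt d Lc (toSite r) ((Lc : ℝ) ^ (d + 1)) (-((Lc : ℝ) ^ (d + 1) * (1 / 2) * (Lc : ℝ) ^ (d + 1))) cΛ j κ)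
              + ∑ ρ', cwsum Lc (fun w => ∑' x₂, ∑ κ₂,
                comp (coDressKBmAt (toSite r) Lc (KInvStep (d := d) Lc j))
                  (dM (coDressKBmAt (toSite r) Lc (KInvStep (d := d) Lc j)) Lc
                    (SpureRecAt d Lc (toSite r) ((Lc : ℝ) ^ (d + 1)) (-((Lc : ℝ) ^ (d + 1) * (1 / 2) * (Lc : ℝ) ^ (d + 1))) cΛ j)
                    (M1At d Lc (toSite r) cΛ j) ν y') ((Lc : ℤ) • w) x₂ (Sum.inr ρ') (Sum.inl κ₂) * gaugeWt Lc y κ₂ x₂)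
                (M1At d Lc (toSite r) cΛ j ρ')))
          + (dM (coDressKBmAt (toSite r) Lc (KInvStep (d := d) Lc j)) Lc (R'' y) (RM y) ν y'
            + dM (conjV (coDressKBmAt (toSite r) Lc (KInvStep (d := d) Lc j))
                (diagK (((1 : ℝ) / 2) • ∑ v ∈ box (d + 1) Lc, legInd (toSite r) ((Lc : ℤ) • y + toSite v)))) Lc
              (SpureRecAt d Lc (toSite r) ((Lc : ℝ) ^ (d + 1)) (-((Lc : ℝ) ^ (d + 1) * (1 / 2) * (Lc : ℝ) ^ (d + 1))) cΛ j)
              (M1At d Lc (toSite r) cΛ j) ν y'))) =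
      -sgnK ((1 / 2 : ℝ) • (
          (dM (coDressKBmAt (toSite r) Lc (KInvStep (d := d) Lc j)) Lc (R y) (RM y) ν y'
            - (stepScale d Lc j * (Lc : ℝ) ^ (d + 1))⁻¹ • (∑ κ, wsum (fun u => ∑' x₂, ∑ κ₂,
                comp (coDressKBmAt (toSite r) Lc (KInvStep (d := d) Lc j))
                  (dM (coDressKBmAt (toSite r) Lc (KInvStep (d := d) Lc j)) Lc
                    (SpureRecAt d Lc (toSite r) ((Lc : ℝ) ^ (d + 1)) (-((Lc : ℝ) ^ (d + 1) * (1 / 2) * (Lc : ℝ) ^ (d + 1))) cΛ j)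
                    (M1At d Lc (toSite r) cΛ j) ν y') u x₂ (Sum.inl κ) (Sum.inl κ₂) * gaugeWt Lc y κ₂ x₂)
                (SpureRecAt d Lc (toSite r) ((Lc : ℝ) ^ (d + 1)) (-((Lc : ℝ) ^ (d + 1) * (1 / 2) * (Lc : ℝ) ^ (d + 1))) cΛ j κ)
              + ∑ ρ', cwsum Lc (fun w => ∑' x₂, ∑ κ₂,
                comp (coDressKBmAt (toSite r) Lc (KInvStep (d := d) Lc j))
                  (dM (coDressKBmAt (toSite r) Lc (KInvStep (d := d) Lc j)) Lc
                    (SpureRecAt d Lc (toSite r) ((Lc : ℝ) ^ (d + 1)) (-((Lc : ℝ) ^ (d + 1) * (1 / 2) * (Lc : ℝ) ^ (d + 1))) cΛ j)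
                    (M1At d Lc (toSite r) cΛ j) ν y') ((Lc : ℤ) • w) x₂ (Sum.inr ρ') (Sum.inl κ₂) * gaugeWt Lc y κ₂ x₂)
                (M1At d Lc (toSite r) cΛ j ρ')))
          + (dM (coDressKBmAt (toSite r) Lc (KInvStep (d := d) Lc j)) Lc (R'' y) (RM y) ν y'
            + dM (conjV (coDressKBmAt (toSite r) Lc (KInvStep (d := d) Lc j))
                (diagK (((1 : ℝ) / 2) • ∑ v ∈ box (d + 1) Lc, legInd (toSite r) ((Lc : ℤ) • y + toSite v)))) Lc
              (SpureRecAt d Lc (toSite r) ((Lc : ℝ) ^ (d + 1)) (-((Lc : ℝ) ^ (d + 1) * (1 / 2) * (Lc : ℝ) ^ (d + 1))) cΛ j)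
              (M1At d Lc (toSite r) cΛ j) ν y'))) := by
  have hSp := trK_SpureRecAt (d := d) hLc hr ((Lc : ℝ) ^ (d + 1)) (-((Lc : ℝ) ^ (d + 1) * (1 / 2) * (Lc : ℝ) ^ (d + 1))) cΛ j
  have hMp : ∀ ρ' w, trK (M1At d Lc (toSite r) cΛ j ρ' w) = -sgnK (M1At d Lc (toSite r) cΛ j ρ' w) := fun ρ' w => trK_M1At (toSite r) cΛ j ρ' w
  exact parityOdd_smul _ (parityOdd_add
    (parityOdd_residual (N := Lc) _ hSp hMp hRp hRMp _ y ν y')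
    (parityOdd_add (parityOdd_dM (N := Lc) _ (hR''p y) (hRMp y) ν y') (parityOdd_dM (N := Lc) _ hSp hMp ν y')))

/-! ## §2 The transported remainder of the next level: class, bound, parity -/

/-- [folklore] **THE NEXT LEVEL's FIRST-SLOT REMAINDER IS A LOCAL STENCIL FAMILY, UNIFORMLY**: from the vertex-family class of the level-`j` residual `𝒩` (all
coarse sites, one constant, rate `δN`) and a local-stencil border remainder `RB Y` (uniform, rate `δN`):
`∀ Y, LocStencil (fun κ′ u′ ↦ a • Σ_{v ∈ box} mmRead Lc (G_j ∘ 𝒩 (Lc•Y+v) κ′ u′ ∘ G_j) + RB Y κ′ u′) C (δ′)` for some `C`, `δ′ > 0`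
(part 1 `exists_locStencil_transport` at `G_j`, `locStencil_smul`, `locStencil_add`). -/
theorem exists_locStencil_transport_wall (hLc : 1 ≤ Lc) {r : Fin (d + 1) → ℕ} (hr : r ∈ box (d + 1) Lc) (j : ℕ) (a : ℝ)
    {𝒩 : (Fin (d + 1) → ℤ) → Fin (d + 1) → (Fin (d + 1) → ℤ) → MKer (d + 1) (Fib d)} {CN δN : ℝ} (hδN : 0 < δN)
    (h𝒩 : ∀ w, VertexFamily (𝒩 w) Lc CN δN)
    {RB : (Fin (d + 1) → ℤ) → Fin (d + 1) → (Fin (d + 1) → ℤ) → MKer (d + 1) (Fib d)} {CB δB : ℝ} (hδB : 0 < δB)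
    (hRB : ∀ Y, LocStencil (RB Y) CB δB) :
    ∃ C δ' : ℝ, 0 < δ' ∧ ∀ Y : Fin (d + 1) → ℤ, LocStencil (fun κ' u' =>
      a • ∑ v ∈ box (d + 1) Lc, mmRead Lc (comp (comp (coDressKBmAt (toSite r) Lc (KInvStep (d := d) Lc j)) (𝒩 ((Lc : ℤ) • Y + toSite v) κ' u'))
        (coDressKBmAt (toSite r) Lc (KInvStep (d := d) Lc j))) + RB Y κ' u') C δ' := by
  obtain ⟨δK, CK, hδK, hCK, hKd⟩ := decays_coDressKBmAt_KInvStep (d := d) hr j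
  set m : ℝ := min (min δN δB) δK with hmdef
  have hm : 0 < m := lt_min (lt_min hδN hδB) hδK
  have hKd' : Decays (coDressKBmAt (toSite r) Lc (KInvStep (d := d) Lc j)) CK m := decays_mono hKd hCK le_rfl (min_le_right _ _)
  have h𝒩' : ∀ w, VertexFamily (𝒩 w) Lc (|CN|) m := fun w ν y' => biLoc_of_le (h𝒩 w ν y') ((min_le_left _ _).trans (min_le_left _ _))
  obtain ⟨C₁, h₁⟩ := exists_locStencil_transport (N := Lc) hLc hKd' hCK hm h𝒩'
  have hmB : m ≤ δB := (min_le_left _ _).trans (min_le_right _ _)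
  have hRB' : ∀ Y, LocStencil (RB Y) (|CB|) (m / 4) := fun Y κ u => biLoc_of_le (hRB Y κ u) (by linarith [hm.le])
  refine ⟨|a| * C₁ + |CB|, m / 4, by positivity, fun Y => ?_⟩
  exact locStencil_add (locStencil_smul a (h₁ Y)) (hRB' Y)

/-- [folklore] **… HENCE THE TRANSPORTED SANDWICH SUM IS UNIFORMLY BOUNDED** (the `h𝒩b` input of `WardLocusRecursiveAll.divW_WrecAt_succ_of_kernelLaw`). -/
theorem exists_bound_transport_wall (hLc : 1 ≤ Lc) {r : Fin (d + 1) → ℕ} (hr : r ∈ box (d + 1) Lc) (j : ℕ)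
    {𝒩 : (Fin (d + 1) → ℤ) → Fin (d + 1) → (Fin (d + 1) → ℤ) → MKer (d + 1) (Fib d)} {CN δN : ℝ} (hδN : 0 < δN)
    (h𝒩 : ∀ w, VertexFamily (𝒩 w) Lc CN δN) :
    ∃ B : ℝ, ∀ (Y : Fin (d + 1) → ℤ) (κ' : Fin (d + 1)) (u' x z : Fin (d + 1) → ℤ) (a b : Fib d),
      |(∑ v ∈ box (d + 1) Lc, mmRead Lc (comp (comp (coDressKBmAt (toSite r) Lc (KInvStep (d := d) Lc j)) (𝒩 ((Lc : ℤ) • Y + toSite v) κ' u'))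
        (coDressKBmAt (toSite r) Lc (KInvStep (d := d) Lc j)))) x z a b| ≤ B := by
  obtain ⟨δK, CK, hδK, hCK, hKd⟩ := decays_coDressKBmAt_KInvStep (d := d) hr j
  set m : ℝ := min δN δK with hmdef
  have hm : 0 < m := lt_min hδN hδK
  have hKd' : Decays (coDressKBmAt (toSite r) Lc (KInvStep (d := d) Lc j)) CK m := decays_mono hKd hCK le_rfl (min_le_right _ _)
  have h𝒩' : ∀ w, VertexFamily (𝒩 w) Lc (|CN|) m := fun w ν y' => biLoc_of_le (h𝒩 w ν y') (min_le_left _ _)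
  exact WardLocusResidualClass.abs_transport_le (N := Lc) hLc hKd' hCK hm h𝒩'

/-- [folklore] **THE NEXT LEVEL's FIRST-SLOT REMAINDER IS ROW-PARITY-ODD** when the residual `𝒩` is (and is localised) and the border remainder's rows are:
`G_j` is spread and sgn-symmetric (`BubbleParity.trK_coDressKBmAt_KInvStep`), so the sandwich and its `mm`-read are parity-odd (leaf-05's
`parityOdd_sandwich`, `parityOdd_mmRead`, `parityOdd_sum`, `parityOdd_smul`). -/
theorem parityOdd_transport_wall {r : Fin (d + 1) → ℕ} (hr : r ∈ box (d + 1) Lc) (j : ℕ) (a : ℝ)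
    {𝒩 : (Fin (d + 1) → ℤ) → Fin (d + 1) → (Fin (d + 1) → ℤ) → MKer (d + 1) (Fib d)} (h𝒩l : ∀ w ν y', Loc (𝒩 w ν y'))
    (h𝒩p : ∀ w ν y', trK (𝒩 w ν y') = -sgnK (𝒩 w ν y'))
    {RB : (Fin (d + 1) → ℤ) → Fin (d + 1) → (Fin (d + 1) → ℤ) → MKer (d + 1) (Fib d)} (hRBp : ∀ Y κ u, trK (RB Y κ u) = -sgnK (RB Y κ u))
    (Y : Fin (d + 1) → ℤ) (κ' : Fin (d + 1)) (u' : Fin (d + 1) → ℤ) :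
    trK (a • ∑ v ∈ box (d + 1) Lc, mmRead Lc (comp (comp (coDressKBmAt (toSite r) Lc (KInvStep (d := d) Lc j)) (𝒩 ((Lc : ℤ) • Y + toSite v) κ' u'))
        (coDressKBmAt (toSite r) Lc (KInvStep (d := d) Lc j))) + RB Y κ' u') =
      -sgnK (a • ∑ v ∈ box (d + 1) Lc, mmRead Lc (comp (comp (coDressKBmAt (toSite r) Lc (KInvStep (d := d) Lc j)) (𝒩 ((Lc : ℤ) • Y + toSite v) κ' u'))
        (coDressKBmAt (toSite r) Lc (KInvStep (d := d) Lc j))) + RB Y κ' u') := by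
  have hGs : Spr (coDressKBmAt (toSite r) Lc (KInvStep (d := d) Lc j)) := spr_of_decays (decays_coDressKBmAt_KInvStep (d := d) hr j)
  have hGt := trK_coDressKBmAt_KInvStep (d := d) hr j
  refine parityOdd_add (parityOdd_smul a (parityOdd_sum _ fun v _ => ?_)) (hRBp Y κ' u')
  exact parityOdd_mmRead Lc (parityOdd_sandwich hGs (h𝒩l _ κ' u') hGt (h𝒩p _ κ' u'))

end Wall

end Summit.QuantumFields.BalabanUV.Beta.WardLocusResidualWall

end
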